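import Summits.Schanuel.Schanuel.Theorems.ZilberEacCriticalFibresLocal
import Summits.Schanuel.Schanuel.Theorems.ZilberEacNearResonantLabels
import HarnessLib

/-!
# The coupled limit system at critical size: a one-variable reduction, III (the supply)

Zilber's Exponential-Algebraic Closedness, case ladder (host summit Schanuel, cell `pub-schanuel`,
seat 2, gen 14).  Continuation of `ZilberEacCriticalFibresZero` / `…Local` (notation there:
`Eⱼ(t) = P + aⱼe^{K+t}`, `g = Re Φ`, `M = (1-α)E₀ + αE₁`, local branch `Φ` with logarithms
`Lⱼ(t) = log(Eⱼ(t)/Eⱼ(t₀)) + log Eⱼ(t₀)`, local inverse `ψ`; `α ∉ ℚ`).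

* **`criticalFibres_supply_at`**: at an admissible point `t₀` (`Eⱼ ≠ 0`, `M ≠ 0`, `g = 0`, so
  `Φ(t₀) ∈ iℝ`) labels `(d_k, n_k) ∈ ℕ × ℤ` with `d_k → ∞`, `αd_k + n_k → -Im Φ(t₀)/2π`
  (`exists_labels_tendsto`, Dirichlet) give target values `τ_k = -2πi(αd_k + n_k) → Φ(t₀)` lying IN
  the dense set `-2πi(αℤ + ℤ)`; with `t_k = ψ(τ_k) → t₀` the pairs
  `ρ^{(k)} = (L₀(t_k) + 2πi(d_k + n_k), L₁(t_k) + 2πin_k)` satisfy `αρ₀ + (1-α)ρ₁ = t_k` exactly, hence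
  are NON-DEGENERATE SOLUTIONS OF THE COUPLED LIMIT SYSTEM `e^{ρⱼ} = P + aⱼe^{K + αρ₀ + (1-α)ρ₁}`,
  with `e^{ρ₀} = E₀(t_k) → E₀(t₀)` and `‖ρ₁ - ρ₀‖ ≥ 2πd_k - O(1) → ∞`.
* `criticalFibres_admissible_values_infinite`: the admissible points near `t₀` contain the curve
  `δ ↦ ψ(Φ(t₀) + iδ)`, along which `E₀` is injective (`a₀ ≠ 0`): infinitely many admissible values.
* **`exists_limitPairs_supply`** (`a₀ ≠ 0`, `α ∉ ℚ`, `P ≠ 0`): an infinite set `𝒯` of limit values,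
  each approached by `e^{ρ₀}` along non-degenerate limit solutions with `‖ρ₁ - ρ₀‖ → ∞` — the input
  of the genericity lemma (`ZilberEacCriticalFibresGeneric`) for THEOREM N₂.

HONEST FRAMING: lemmas toward explicit members of an OPEN cell (`ECCell 3 2`);
NOT Schanuel's conjecture; EAC ⇏ SC.
-/

noncomputable section

open Complex Filter Topology

set_option linter.dupNamespace false

namespace Summit.Schanuel.Schanuel.Theorems

section Supply
/-- **Supply of non-degenerate limit solutions at an admissible point.**  See the module docstring.
(new) -/
theorem criticalFibres_supply_at (a₀ a₁ : ℂ) {α : ℝ} (hα : Irrational α) (K : ℂ) {P : ℂ}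
    (hP : P ≠ 0) {t₀ : ℂ}
    (h₀ : P + a₀ * exp (K + t₀) ≠ 0) (h₁ : P + a₁ * exp (K + t₀) ≠ 0)
    (hM : (1 - (α : ℂ)) * (P + a₀ * exp (K + t₀)) + α * (P + a₁ * exp (K + t₀)) ≠ 0)
    (hg : α * Real.log ‖P + a₀ * exp (K + t₀)‖ + (1 - α) * Real.log ‖P + a₁ * exp (K + t₀)‖ -
      t₀.re = 0) :
    ∃ ρ : ℕ → ℂ × ℂ,
      (∀ᶠ k in atTop,
        exp (ρ k).1 = P + a₀ * exp (K + (α : ℂ) * (ρ k).1 + (1 - (α : ℂ)) * (ρ k).2) ∧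
        exp (ρ k).2 = P + a₁ * exp (K + (α : ℂ) * (ρ k).1 + (1 - (α : ℂ)) * (ρ k).2) ∧
        (1 - (α : ℂ)) * exp (ρ k).1 + α * exp (ρ k).2 ≠ 0) ∧
      Tendsto (fun k => ‖(ρ k).2 - (ρ k).1‖) atTop atTop ∧
      Tendsto (fun k => exp (ρ k).1) atTop (𝓝 (P + a₀ * exp (K + t₀))) := by
  set E₀ : ℂ → ℂ := fun t => P + a₀ * exp (K + t) with hE₀
  set E₁ : ℂ → ℂ := fun t => P + a₁ * exp (K + t) with hE₁
  set L₀ : ℂ → ℂ := fun t => log (E₀ t / E₀ t₀) + log (E₀ t₀) with hL₀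
  set L₁ : ℂ → ℂ := fun t => log (E₁ t / E₁ t₀) + log (E₁ t₀) with hL₁
  set Φ : ℂ → ℂ := fun t => (α : ℂ) * L₀ t + (1 - (α : ℂ)) * L₁ t - t with hΦ
  obtain ⟨ψ, hψlim, hψinv⟩ := criticalFibres_localInverse a₀ a₁ α K hP h₀ h₁ hM
  change Tendsto ψ (𝓝 (Φ t₀)) (𝓝 t₀) at hψlim
  change ∀ᶠ τ in 𝓝 (Φ t₀), Φ (ψ τ) = τ at hψinv
  -- `Re Φ(t₀) = g(t₀) = 0`, so `Φ(t₀) = -2πi θ`, `θ = -Im Φ(t₀)/2π`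
  have hre0 : (Φ t₀).re = 0 := by
    have := re_localPhi E₀ E₁ α h₀ h₁ h₀ h₁
    rw [this]
    exact hg
  set θ : ℝ := -(Φ t₀).im / (2 * Real.pi) with hθ
  obtain ⟨d, n₁, hd, hdn⟩ := exists_labels_tendsto hα θ
  set τ : ℕ → ℂ := fun k => -(2 * Real.pi * I) * (((α * d k + n₁ k : ℝ)) : ℂ) with hτ
  have hτlim : Tendsto τ atTop (𝓝 (Φ t₀)) := by
    have hc : Continuous fun x : ℝ => -(2 * Real.pi * I) * (x : ℂ) := by fun_prop
    have h : Tendsto (fun k => -(2 * Real.pi * I) * (((α * d k + n₁ k : ℝ)) : ℂ)) atTop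
        (𝓝 (-(2 * Real.pi * I) * ((θ : ℝ) : ℂ))) := (hc.tendsto θ).comp hdn
    have e : -(2 * Real.pi * I) * ((θ : ℝ) : ℂ) = Φ t₀ := by
      rw [hθ]; exact neg_two_pi_I_mul_eq_of_re_eq_zero hre0
    rw [e] at h
    exact h
  -- `t_k = ψ(τ_k) → t₀`; eventually everything is good there
  have htlim : Tendsto (fun k => ψ (τ k)) atTop (𝓝 t₀) := hψlim.comp hτlim
  have hcont₀ : Continuous E₀ := by rw [hE₀]; fun_prop
  have hcont₁ : Continuous E₁ := by rw [hE₁]; fun_prop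
  have hne₀ : ∀ᶠ k in atTop, E₀ (ψ (τ k)) ≠ 0 :=
    ((hcont₀.tendsto t₀).comp htlim).eventually_ne h₀
  have hne₁ : ∀ᶠ k in atTop, E₁ (ψ (τ k)) ≠ 0 :=
    ((hcont₁.tendsto t₀).comp htlim).eventually_ne h₁
  have hMk : ∀ᶠ k in atTop, (1 - (α : ℂ)) * E₀ (ψ (τ k)) + α * E₁ (ψ (τ k)) ≠ 0 := by
    have hc : Continuous fun t => (1 - (α : ℂ)) * E₀ t + α * E₁ t := by fun_prop
    exact ((hc.tendsto t₀).comp htlim).eventually_ne hM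
  have hinvk : ∀ᶠ k in atTop, Φ (ψ (τ k)) = τ k := hτlim.eventually hψinv
  -- the base solutions
  set ρ : ℕ → ℂ × ℂ := fun k => (L₀ (ψ (τ k)) + 2 * Real.pi * I * ((d k : ℂ) + (n₁ k : ℂ)),
    L₁ (ψ (τ k)) + 2 * Real.pi * I * (n₁ k : ℂ)) with hρ
  refine ⟨ρ, ?_, ?_, ?_⟩
  · filter_upwards [hne₀, hne₁, hMk, hinvk] with k hk₀ hk₁ hkM hkinv
    have hexpL₀ : exp (L₀ (ψ (τ k))) = E₀ (ψ (τ k)) := exp_log_div_add_log hk₀ h₀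
    have hexpL₁ : exp (L₁ (ψ (τ k))) = E₁ (ψ (τ k)) := exp_log_div_add_log hk₁ h₁
    have hper₀ : exp (2 * Real.pi * I * ((d k : ℂ) + (n₁ k : ℂ))) = 1 := by
      have := Complex.exp_int_mul_two_pi_mul_I ((d k : ℤ) + n₁ k)
      rw [← this]; congr 1; push_cast; ring
    have hper₁ : exp (2 * Real.pi * I * (n₁ k : ℂ)) = 1 := by
      have := Complex.exp_int_mul_two_pi_mul_I (n₁ k)
      rw [← this]; congr 1; ring
    have hexp₀ : exp (ρ k).1 = E₀ (ψ (τ k)) := by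
      simp only [hρ]
      rw [Complex.exp_add, hexpL₀, hper₀, mul_one]
    have hexp₁ : exp (ρ k).2 = E₁ (ψ (τ k)) := by
      simp only [hρ]
      rw [Complex.exp_add, hexpL₁, hper₁, mul_one]
    -- the key identity `K + αρ₀ + (1-α)ρ₁ = K + t_k`
    have hlin : K + (α : ℂ) * (ρ k).1 + (1 - (α : ℂ)) * (ρ k).2 = K + ψ (τ k) := by
      have hτk : τ k = -(2 * Real.pi * I) * ((α : ℂ) * (d k : ℂ) + (n₁ k : ℂ)) := by
        simp only [hτ]; push_cast; ring
      have hΦk : (α : ℂ) * L₀ (ψ (τ k)) + (1 - (α : ℂ)) * L₁ (ψ (τ k)) - ψ (τ k) =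
          -(2 * Real.pi * I) * ((α : ℂ) * (d k : ℂ) + (n₁ k : ℂ)) := by
        calc (α : ℂ) * L₀ (ψ (τ k)) + (1 - (α : ℂ)) * L₁ (ψ (τ k)) - ψ (τ k) = Φ (ψ (τ k)) := rfl
          _ = τ k := hkinv
          _ = _ := hτk
      simp only [hρ]
      linear_combination hΦk
    refine ⟨?_, ?_, ?_⟩
    · rw [hexp₀, hlin]
    · rw [hexp₁, hlin]
    · rw [hexp₀, hexp₁]; exact hkM
  · -- `‖ρ₁ - ρ₀‖ ≥ 2π d_k - ‖L₁(t_k) - L₀(t_k)‖ → ∞`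
    have hLcont : ContinuousAt (fun t => L₁ t - L₀ t) t₀ := by
      have hc₀ : ContinuousAt L₀ t₀ := by
        have hs : E₀ t₀ / E₀ t₀ ∈ slitPlane := by rw [div_self h₀]; exact one_mem_slitPlane
        exact ((hcont₀.continuousAt.div_const _).clog hs).add continuousAt_const
      have hc₁ : ContinuousAt L₁ t₀ := by
        have hs : E₁ t₀ / E₁ t₀ ∈ slitPlane := by rw [div_self h₁]; exact one_mem_slitPlane
        exact ((hcont₁.continuousAt.div_const _).clog hs).add continuousAt_const
      exact hc₁.sub hc₀
    have hbd : ∀ᶠ k in atTop, ‖L₁ (ψ (τ k)) - L₀ (ψ (τ k))‖ ≤ ‖L₁ t₀ - L₀ t₀‖ + 1 := by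
      have h := (hLcont.tendsto.comp htlim)
      have h2 := (continuous_norm.tendsto _).comp h
      have h3 := h2.eventually (Iic_mem_nhds (lt_add_one ‖L₁ t₀ - L₀ t₀‖))
      filter_upwards [h3] with k hk
      exact hk
    have hlow : ∀ᶠ k in atTop, 2 * Real.pi * (d k : ℝ) - (‖L₁ t₀ - L₀ t₀‖ + 1) ≤ ‖(ρ k).2 - (ρ k).1‖ := by
      filter_upwards [hbd] with k hk
      have e : (ρ k).2 - (ρ k).1 = (L₁ (ψ (τ k)) - L₀ (ψ (τ k))) - 2 * Real.pi * I * (d k : ℂ) := by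
        simp only [hρ]; ring
      rw [e]
      have hn : ‖(2 * Real.pi * I * (d k : ℂ) : ℂ)‖ = 2 * Real.pi * (d k : ℝ) := by
        rw [norm_mul, norm_mul, norm_mul, Complex.norm_I, Complex.norm_real, Complex.norm_two,
          Complex.norm_natCast, Real.norm_eq_abs, abs_of_pos Real.pi_pos, mul_one]
      have h1 := norm_sub_norm_le (2 * Real.pi * I * (d k : ℂ)) (L₁ (ψ (τ k)) - L₀ (ψ (τ k)))
      have e2 : ‖2 * Real.pi * I * (d k : ℂ) - (L₁ (ψ (τ k)) - L₀ (ψ (τ k)))‖ =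
          ‖(L₁ (ψ (τ k)) - L₀ (ψ (τ k))) - 2 * Real.pi * I * (d k : ℂ)‖ := norm_sub_rev _ _
      rw [hn, e2] at h1
      linarith
    refine tendsto_atTop_mono' atTop hlow ?_
    have hd' : Tendsto (fun k => (d k : ℝ)) atTop atTop := tendsto_natCast_atTop_atTop.comp hd
    exact tendsto_atTop_add_const_right _ _ (hd'.const_mul_atTop (by positivity))
  · -- `exp ρ₀ = E₀(t_k) → E₀(t₀)`
    have h := (hcont₀.tendsto t₀).comp htlim
    refine h.congr' ?_
    filter_upwards [hne₀] with k hk₀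
    simp only [Function.comp_apply, hρ]
    rw [Complex.exp_add, exp_log_div_add_log hk₀ h₀]
    have hper₀ : exp (2 * Real.pi * I * ((d k : ℂ) + (n₁ k : ℂ))) = 1 := by
      have := Complex.exp_int_mul_two_pi_mul_I ((d k : ℤ) + n₁ k)
      rw [← this]; congr 1; push_cast; ring
    rw [hper₀, mul_one]

/-- **Infinitely many admissible values `E₀(t)`** near one admissible point (`a₀ ≠ 0`): the points
`ψ(Φ(t₀) + iδ)`, `δ` small, are admissible and have pairwise different `E₀`. (new) -/
theorem criticalFibres_admissible_values_infinite (a₀ a₁ : ℂ) (ha₀ : a₀ ≠ 0) (α : ℝ) (K : ℂ)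
    {P : ℂ} (hP : P ≠ 0) {t₀ : ℂ}
    (h₀ : P + a₀ * exp (K + t₀) ≠ 0) (h₁ : P + a₁ * exp (K + t₀) ≠ 0)
    (hM : (1 - (α : ℂ)) * (P + a₀ * exp (K + t₀)) + α * (P + a₁ * exp (K + t₀)) ≠ 0)
    (hg : α * Real.log ‖P + a₀ * exp (K + t₀)‖ + (1 - α) * Real.log ‖P + a₁ * exp (K + t₀)‖ -
      t₀.re = 0) :
    {T : ℂ | ∃ t : ℂ, P + a₀ * exp (K + t) ≠ 0 ∧ P + a₁ * exp (K + t) ≠ 0 ∧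
      (1 - (α : ℂ)) * (P + a₀ * exp (K + t)) + α * (P + a₁ * exp (K + t)) ≠ 0 ∧
      α * Real.log ‖P + a₀ * exp (K + t)‖ + (1 - α) * Real.log ‖P + a₁ * exp (K + t)‖ - t.re = 0 ∧
      T = P + a₀ * exp (K + t)}.Infinite := by
  set E₀ : ℂ → ℂ := fun t => P + a₀ * exp (K + t) with hE₀
  set E₁ : ℂ → ℂ := fun t => P + a₁ * exp (K + t) with hE₁
  set Φ : ℂ → ℂ := fun t => (α : ℂ) * (log (E₀ t / E₀ t₀) + log (E₀ t₀)) +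
    (1 - (α : ℂ)) * (log (E₁ t / E₁ t₀) + log (E₁ t₀)) - t with hΦ
  obtain ⟨ψ, hψlim, hψinv⟩ := criticalFibres_localInverse a₀ a₁ α K hP h₀ h₁ hM
  change Tendsto ψ (𝓝 (Φ t₀)) (𝓝 t₀) at hψlim
  change ∀ᶠ τ in 𝓝 (Φ t₀), Φ (ψ τ) = τ at hψinv
  have hcont₀ : Continuous E₀ := by rw [hE₀]; fun_prop
  have hcont₁ : Continuous E₁ := by rw [hE₁]; fun_prop
  -- the curve `δ ↦ ψ(Φ t₀ + δ i)`
  set γ : ℝ → ℂ := fun δ => Φ t₀ + (δ : ℂ) * I with hγ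
  have hγlim : Tendsto γ (𝓝 0) (𝓝 (Φ t₀)) := by
    have hc : Continuous γ := by rw [hγ]; fun_prop
    have := hc.tendsto 0
    simpa [hγ] using this
  have htlim : Tendsto (fun δ => ψ (γ δ)) (𝓝 0) (𝓝 t₀) := hψlim.comp hγlim
  have hgood : ∀ᶠ δ in 𝓝 (0 : ℝ), E₀ (ψ (γ δ)) ≠ 0 ∧ E₁ (ψ (γ δ)) ≠ 0 ∧
      (1 - (α : ℂ)) * E₀ (ψ (γ δ)) + α * E₁ (ψ (γ δ)) ≠ 0 ∧ Φ (ψ (γ δ)) = γ δ ∧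
      ‖ψ (γ δ) - t₀‖ < 1 := by
    have hne₀ := ((hcont₀.tendsto t₀).comp htlim).eventually_ne h₀
    have hne₁ := ((hcont₁.tendsto t₀).comp htlim).eventually_ne h₁
    have hc : Continuous fun t => (1 - (α : ℂ)) * E₀ t + α * E₁ t := by fun_prop
    have hMδ := ((hc.tendsto t₀).comp htlim).eventually_ne hM
    have hinvδ : ∀ᶠ δ in 𝓝 (0 : ℝ), Φ (ψ (γ δ)) = γ δ := hγlim.eventually hψinv
    have hball : ∀ᶠ δ in 𝓝 (0 : ℝ), ‖ψ (γ δ) - t₀‖ < 1 := by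
      have := htlim.eventually (Metric.ball_mem_nhds t₀ one_pos)
      filter_upwards [this] with δ hδ
      simpa [Metric.mem_ball, dist_eq_norm] using hδ
    filter_upwards [hne₀, hne₁, hMδ, hinvδ, hball] with δ a b c d e
    exact ⟨a, b, c, d, e⟩
  obtain ⟨ε, hε, hεgood⟩ := Metric.eventually_nhds_iff.1 hgood
  have hIoo : ∀ δ ∈ Set.Ioo (-ε) ε, E₀ (ψ (γ δ)) ≠ 0 ∧ E₁ (ψ (γ δ)) ≠ 0 ∧
      (1 - (α : ℂ)) * E₀ (ψ (γ δ)) + α * E₁ (ψ (γ δ)) ≠ 0 ∧ Φ (ψ (γ δ)) = γ δ ∧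
      ‖ψ (γ δ) - t₀‖ < 1 := by
    intro δ hδ
    apply hεgood
    rw [Real.dist_eq, sub_zero]
    exact abs_lt.2 hδ
  -- injectivity of `δ ↦ E₀(ψ(γ δ))` on the interval
  have hinj : Set.InjOn (fun δ => E₀ (ψ (γ δ))) (Set.Ioo (-ε) ε) := by
    intro δ hδ δ' hδ' heq
    obtain ⟨-, -, -, hΦδ, hbδ⟩ := hIoo δ hδ
    obtain ⟨-, -, -, hΦδ', hbδ'⟩ := hIoo δ' hδ'
    simp only [hE₀] at heq
    have hexp : exp (K + ψ (γ δ)) = exp (K + ψ (γ δ')) :=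
      mul_left_cancel₀ ha₀ (by linear_combination heq)
    obtain ⟨n, hn⟩ := Complex.exp_eq_exp_iff_exists_int.1 hexp
    have hdiff : ψ (γ δ) - ψ (γ δ') = n * (2 * Real.pi * I) := by linear_combination hn
    have hnorm : ‖(n : ℂ) * (2 * Real.pi * I)‖ < Real.pi := by
      rw [← hdiff]
      calc ‖ψ (γ δ) - ψ (γ δ')‖ = ‖(ψ (γ δ) - t₀) - (ψ (γ δ') - t₀)‖ := by ring_nf
        _ ≤ ‖ψ (γ δ) - t₀‖ + ‖ψ (γ δ') - t₀‖ := norm_sub_le _ _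
        _ < 1 + 1 := by linarith
        _ ≤ Real.pi := by linarith [Real.pi_gt_three]
    have hn0 := int_eq_zero_of_norm_mul_two_pi_I_lt hnorm
    rw [hn0] at hdiff
    have hψeq : ψ (γ δ) = ψ (γ δ') := by simpa [sub_eq_zero] using hdiff
    have hγeq : γ δ = γ δ' := by rw [← hΦδ, ← hΦδ', hψeq]
    simp only [hγ, add_right_inj] at hγeq
    have := (mul_eq_mul_right_iff.1 hγeq).resolve_right Complex.I_ne_zero
    exact_mod_cast this
  have hinf : ((fun δ => E₀ (ψ (γ δ))) '' Set.Ioo (-ε) ε).Infinite :=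
    (Set.Ioo_infinite (by linarith)).image hinj
  refine hinf.mono ?_
  rintro T ⟨δ, hδ, rfl⟩
  obtain ⟨hn₀, hn₁, hMδ, hΦδ, -⟩ := hIoo δ hδ
  refine ⟨ψ (γ δ), hn₀, hn₁, hMδ, ?_, rfl⟩
  have hre_t : (Φ (ψ (γ δ))).re = α * Real.log ‖E₀ (ψ (γ δ))‖ +
      (1 - α) * Real.log ‖E₁ (ψ (γ δ))‖ - (ψ (γ δ)).re :=
    re_localPhi E₀ E₁ α h₀ h₁ hn₀ hn₁
  have hre_0 : (Φ t₀).re = 0 := by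
    have := re_localPhi E₀ E₁ α h₀ h₁ h₀ h₁
    rw [this]; exact hg
  change α * Real.log ‖E₀ (ψ (γ δ))‖ + (1 - α) * Real.log ‖E₁ (ψ (γ δ))‖ - (ψ (γ δ)).re = 0
  rw [← hre_t, hΦδ]
  simp [hγ, hre_0]

/-- **THE SUPPLY.**  `a₀ ≠ 0`, `α ∉ ℚ`, `P ≠ 0`: an infinite set `𝒯 ⊆ ℂ` such that every `T ∈ 𝒯` is
the limit of `e^{ρ₀}` along a sequence of NON-DEGENERATE solutions `ρ = (ρ₀, ρ₁)` of the coupled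
limit system `e^{ρⱼ} = P + aⱼe^{K + αρ₀ + (1-α)ρ₁}` with `‖ρ₁ - ρ₀‖ → ∞`. (new) -/
theorem exists_limitPairs_supply (a₀ a₁ : ℂ) (ha₀ : a₀ ≠ 0) {α : ℝ} (hα : Irrational α) (K : ℂ)
    {P : ℂ} (hP : P ≠ 0) :
    ∃ 𝒯 : Set ℂ, 𝒯.Infinite ∧ ∀ T ∈ 𝒯, ∃ ρ : ℕ → ℂ × ℂ,
      (∀ᶠ k in atTop,
        exp (ρ k).1 = P + a₀ * exp (K + (α : ℂ) * (ρ k).1 + (1 - (α : ℂ)) * (ρ k).2) ∧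
        exp (ρ k).2 = P + a₁ * exp (K + (α : ℂ) * (ρ k).1 + (1 - (α : ℂ)) * (ρ k).2) ∧
        (1 - (α : ℂ)) * exp (ρ k).1 + α * exp (ρ k).2 ≠ 0) ∧
      Tendsto (fun k => ‖(ρ k).2 - (ρ k).1‖) atTop atTop ∧
      Tendsto (fun k => exp (ρ k).1) atTop (𝓝 T) := by
  have hα0 : α ≠ 0 := by
    intro h; rw [h] at hα; exact hα ⟨0, by simp⟩
  obtain ⟨t₀, h₀, h₁, hM, hg⟩ := exists_admissible_criticalFibres a₀ a₁ ha₀ hα0 K hP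
  refine ⟨_, criticalFibres_admissible_values_infinite a₀ a₁ ha₀ α K hP h₀ h₁ hM hg, ?_⟩
  rintro T ⟨t, ht₀, ht₁, htM, htg, rfl⟩
  exact criticalFibres_supply_at a₀ a₁ hα K hP ht₀ ht₁ htM htg

end Supply

end Summit.Schanuel.Schanuel.Theorems

end
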